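import Mathlib
import HarnessLib
import Summits.HubbardSuperconductivity.HubbardSuperconductivity.Theorems.KLProgrammeKLRegimeWickBubbleChannelsGeneral
import Summits.HubbardSuperconductivity.HubbardSuperconductivity.Theorems.KLProgrammeKLRegimeWickScaleFlowSource
import Summits.HubbardSuperconductivity.HubbardSuperconductivity.Theorems.KLProgrammeKLRegimeWickScaleFlowLines

/-!
# Route `KLProgramme` — crux K3, ENGINE child (gen 6 stmt-HubbardSuperconductivity-20236 `KLRegimeEngineV16`), stub `stub_engine_step_values`,
# conjunct (E2-v10) at `1 ≤ n`: the RICCATI SPLIT of the within-slice source — `klws_source_split`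

Cell gate-hubbard-kl, seat hubbard-kl-k3c1-p1 (g6), technique «composed-map remainder propagation».  Capstone of the model-level bridge: the
source of the scale flow of the real-cutoff Wick pair kernel (`klws_hasDerivAt_vertexFn_wickActionR_cross`, p511554:
`∂_Λ K_Λ(Q)(x,y) = −½·𝒱₄(dblFold(Δ_×(Ċ_Λ)(e^{Δ_×(D_Λ)}(𝒲_Λ⁰·𝒲_Λ¹))))(Z(x,y))`) SPLITS, exactly, into

  `−(K_Λ·diag(ḃ_Λ)·K_Λ)(x,y)`                                   — the Riccati (particle–particle ladder) term,
  `−½·𝒱₄(dblFold(Δ_×(Ċ_Λ)((e^{Δ_×(D_Λ)} − Δ_×(D_Λ))(𝒲_Λ⁰·𝒲_Λ¹))))(Z)` — every other line number (`k = 0`: leg dressing; `k ≥ 2`: overlapping loops),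
  `−(βL²)⁻³·(PHd − PHx − 2·S62)`                               — the two-line particle–hole channels and the `𝒲₆⊗𝒲₂` closing,

with the RUNG RATE `ḃ_Λ(z) = (βL²)⁻³·λ_Λ(z)`, `λ_Λ(z) = ℓ_D(p)ℓ_Ċ(p̄) + ℓ_Ċ(p)ℓ_D(p̄)`, `p = (ν, p⃗)`, `p̄ = (−ν, Q − p⃗)`, line values
`ℓ_Ċ = ẇ_Λ·βL²·ĝ_K` (`klws_contr_derivHardCov_eq_diagContr`) and `ℓ_D = (1 − w_Λ)·βL²·ĝ_K` (`klws_contr_covBelowCT_eq_diagContr`) — i.e.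
`ḃ_Λ(z) = (βL²)⁻¹ĝ_K(p)ĝ_K(p̄)·∂_Λ[−(1 − w_Λ(p))(1 − w_Λ(p̄))]·(−1)…` = the `Λ`-derivative of `b_Λ(z) := −(βL²)⁻¹ĝ_K(p)ĝ_K(p̄)(1 − w_Λ(p))(1 − w_Λ(p̄))`,
the shape `c(z)·u_Λ(z)` of `…WickScaleFlowRungs` (p509476).  So `X := Γ̇ + Γ·diag ḃ·Γ` of `kltc_riccati_duhamel_weighted` /
`klws_wickStep_of_scaleFlow` IS the sum of the last two lines (times `Λ₁ − Λ₀` on the affine path): two-vertex, non-ladder, every term either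
gained (ph: `phGain`; `k ≥ 2`: overlapping) or a leg dressing — the (E2-v10) budget's classes, with no all-orders chain extraction.

* `klws_source_split` — the identity above at every `Λ ≠ 0` with `Z^K_Λ ≠ 0`, all external `x, y ∈ TorusSite 2 L × MatsubaraIdx M`.

Exact algebra over the landed identities (`vertexFn_dblFold_bubble_pairKernel_wickActionR`); nothing about sizes or physics is asserted.  0 kit.
-/

noncomputable section

namespace Summit.HubbardSuperconductivity.HubbardSuperconductivity.Theorems.KLRegimeWick

set_option linter.dupNamespace false -- summit = problem name (single-conjunct summit), D-0017

open Literature.MathematicalPhysics.QuantumLattice GrassmannAlgebra Finset Matrix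
open Literature.Probability.LatticeModels
open Summit.HubbardSuperconductivity.HubbardSuperconductivity.Theorems.TwoPointAssembly
open Summit.HubbardSuperconductivity.HubbardSuperconductivity.Theorems.KLProgrammeLegKernels
open Summit.HubbardSuperconductivity.HubbardSuperconductivity.Theorems.KLRegimeSplit

section Model

variable (L M : ℕ) [NeZero L] [NeZero M] (β U μ : ℝ) (K : TrigPolyC4v)

/-- **The Riccati split of the within-slice source.**  With `W = 𝒲_Λ` (real cutoff), `Ċ = ∂_Λ C^K_{>Λ}`, `D = C^K_{≤Λ}`, line values
`ℓ_Ċ(p) = ẇ_Λ(p)·βL²·ĝ_K(p)`, `ℓ_D(p) = (1 − w_Λ(p))·βL²·ĝ_K(p)`, `λ(z) = ℓ_D(p)ℓ_Ċ(p̄) + ℓ_Ċ(p)ℓ_D(p̄)` and `K(a,b) = 𝒱₄(W)(pair labels)`: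
`−½·𝒱₄(dblFold(Δ_×(Ċ)(e^{Δ_×(D)}(W⁰W¹))))(Z(x,y)) = −(βL²)⁻³·Σ_z λ(z)·K(x,z)·K(z,y)`
`  + (−½·𝒱₄(dblFold(Δ_×(Ċ)((e^{Δ_×(D)} − Δ_×(D))(W⁰W¹))))(Z(x,y)) − (βL²)⁻³·(PHd − PHx − 2·S62))`. -/
theorem klws_source_split (hβ : β ≠ 0) {Λ : ℝ} (hΛ : Λ ≠ 0) (Q : TorusSite 2 L) (x y : TorusSite 2 L × MatsubaraIdx M) :
    -((2 : ℂ)⁻¹ * vertexFn L M β (dblFold ℂ (grassmannLaplacian ℂ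
        (crossCov ℂ (Matrix.of fun X Y : HubbardFieldIdx L M => deriv (fun Λ' : ℝ => hubbardCovAboveCT L M β μ 0 K Λ' X Y) Λ))
        (gaussConv ℂ (crossCov ℂ (hubbardCovBelowCT L M β μ 0 K Λ))
          (dblCopy ℂ 0 (gaussConv ℂ (hubbardCovBelowCT L M β μ 0 K Λ) (hubbardEffectiveActionCT L M β U μ 0 K Λ)) *
            dblCopy ℂ 1 (gaussConv ℂ (hubbardCovBelowCT L M β μ 0 K Λ) (hubbardEffectiveActionCT L M β U μ 0 K Λ)))))) 4
        ![(((y.2, y.1), 0), 0), (((y.2.rev, Q - y.1), 1), 0), (((x.2.rev, Q - x.1), 1), 1), (((x.2, x.1), 0), 1)]) =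
      -(((((β * (L : ℝ) ^ 2 : ℝ) : ℂ)) ^ 3)⁻¹ *
          ∑ z : TorusSite 2 L × MatsubaraIdx M,
            ((((1 - hubbardCutoffWeightCT L M β μ K Λ (z.2, z.1) : ℝ) : ℂ) * (((β * (L : ℝ) ^ 2 : ℝ) : ℂ) * propCT L M β μ K (z.2, z.1))) *
                (((deriv (fun Λ' : ℝ => hubbardCutoffWeightCT L M β μ K Λ' (z.2.rev, Q - z.1)) Λ : ℝ) : ℂ) *
                  (((β * (L : ℝ) ^ 2 : ℝ) : ℂ) * propCT L M β μ K (z.2.rev, Q - z.1))) +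
              (((deriv (fun Λ' : ℝ => hubbardCutoffWeightCT L M β μ K Λ' (z.2, z.1)) Λ : ℝ) : ℂ) *
                  (((β * (L : ℝ) ^ 2 : ℝ) : ℂ) * propCT L M β μ K (z.2, z.1))) *
                ((((1 - hubbardCutoffWeightCT L M β μ K Λ (z.2.rev, Q - z.1) : ℝ) : ℂ) *
                  (((β * (L : ℝ) ^ 2 : ℝ) : ℂ) * propCT L M β μ K (z.2.rev, Q - z.1))))) *
            (vertexFn L M β (gaussConv ℂ (hubbardCovBelowCT L M β μ 0 K Λ) (hubbardEffectiveActionCT L M β U μ 0 K Λ)) 4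
                ![(((z.2, z.1), 0), 0), (((z.2.rev, Q - z.1), 1), 0), (((x.2.rev, Q - x.1), 1), 1), (((x.2, x.1), 0), 1)] *
              vertexFn L M β (gaussConv ℂ (hubbardCovBelowCT L M β μ 0 K Λ) (hubbardEffectiveActionCT L M β U μ 0 K Λ)) 4
                ![(((y.2, y.1), 0), 0), (((y.2.rev, Q - y.1), 1), 0), (((z.2.rev, Q - z.1), 1), 1), (((z.2, z.1), 0), 1)])) +
      (-((2 : ℂ)⁻¹ * vertexFn L M β (dblFold ℂ (grassmannLaplacian ℂ
          (crossCov ℂ (Matrix.of fun X Y : HubbardFieldIdx L M => deriv (fun Λ' : ℝ => hubbardCovAboveCT L M β μ 0 K Λ' X Y) Λ))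
          ((gaussConv ℂ (crossCov ℂ (hubbardCovBelowCT L M β μ 0 K Λ)) -
              grassmannLaplacian ℂ (crossCov ℂ (hubbardCovBelowCT L M β μ 0 K Λ)))
            (dblCopy ℂ 0 (gaussConv ℂ (hubbardCovBelowCT L M β μ 0 K Λ) (hubbardEffectiveActionCT L M β U μ 0 K Λ)) *
              dblCopy ℂ 1 (gaussConv ℂ (hubbardCovBelowCT L M β μ 0 K Λ) (hubbardEffectiveActionCT L M β U μ 0 K Λ)))))) 4
          ![(((y.2, y.1), 0), 0), (((y.2.rev, Q - y.1), 1), 0), (((x.2.rev, Q - x.1), 1), 1), (((x.2, x.1), 0), 1)]) -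
        ((((β * (L : ℝ) ^ 2 : ℝ) : ℂ)) ^ 3)⁻¹ *
          ((∑ p : FreqMomentum L M, ∑ σ : Fin 2, ∑ p' : FreqMomentum L M,
              if matsubaraInt M p'.1 + matsubaraInt M y.2 = matsubaraInt M p.1 + matsubaraInt M x.2 ∧ p'.2 = p.2 + x.1 - y.1 then
                ((((1 - hubbardCutoffWeightCT L M β μ K Λ p : ℝ) : ℂ) * (((β * (L : ℝ) ^ 2 : ℝ) : ℂ) * propCT L M β μ K p)) *
                    (((deriv (fun Λ' : ℝ => hubbardCutoffWeightCT L M β μ K Λ' p') Λ : ℝ) : ℂ) *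
                      (((β * (L : ℝ) ^ 2 : ℝ) : ℂ) * propCT L M β μ K p')) +
                  (((deriv (fun Λ' : ℝ => hubbardCutoffWeightCT L M β μ K Λ' p) Λ : ℝ) : ℂ) *
                      (((β * (L : ℝ) ^ 2 : ℝ) : ℂ) * propCT L M β μ K p)) *
                    ((((1 - hubbardCutoffWeightCT L M β μ K Λ p' : ℝ) : ℂ) * (((β * (L : ℝ) ^ 2 : ℝ) : ℂ) * propCT L M β μ K p')))) *
                  (vertexFn L M β (gaussConv ℂ (hubbardCovBelowCT L M β μ 0 K Λ) (hubbardEffectiveActionCT L M β U μ 0 K Λ)) 4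
                      ![((p, σ), 1), ((p', σ), 0), (((y.2, y.1), 0), 0), (((x.2, x.1), 0), 1)] *
                    vertexFn L M β (gaussConv ℂ (hubbardCovBelowCT L M β μ 0 K Λ) (hubbardEffectiveActionCT L M β U μ 0 K Λ)) 4
                      ![((p, σ), 0), ((p', σ), 1), (((y.2.rev, Q - y.1), 1), 0), (((x.2.rev, Q - x.1), 1), 1)])
              else 0) -
            (∑ p : FreqMomentum L M, ∑ p' : FreqMomentum L M,
              if matsubaraInt M p'.1 + matsubaraInt M x.2 + matsubaraInt M y.2 + 1 = matsubaraInt M p.1 ∧ p'.2 = p.2 + Q - x.1 - y.1 then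
                ((((1 - hubbardCutoffWeightCT L M β μ K Λ p : ℝ) : ℂ) * (((β * (L : ℝ) ^ 2 : ℝ) : ℂ) * propCT L M β μ K p)) *
                    (((deriv (fun Λ' : ℝ => hubbardCutoffWeightCT L M β μ K Λ' p') Λ : ℝ) : ℂ) *
                      (((β * (L : ℝ) ^ 2 : ℝ) : ℂ) * propCT L M β μ K p')) +
                  (((deriv (fun Λ' : ℝ => hubbardCutoffWeightCT L M β μ K Λ' p) Λ : ℝ) : ℂ) *
                      (((β * (L : ℝ) ^ 2 : ℝ) : ℂ) * propCT L M β μ K p)) *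
                    ((((1 - hubbardCutoffWeightCT L M β μ K Λ p' : ℝ) : ℂ) * (((β * (L : ℝ) ^ 2 : ℝ) : ℂ) * propCT L M β μ K p')))) *
                  (vertexFn L M β (gaussConv ℂ (hubbardCovBelowCT L M β μ 0 K Λ) (hubbardEffectiveActionCT L M β U μ 0 K Λ)) 4
                      ![((p, 0), 1), ((p', 1), 0), (((y.2, y.1), 0), 0), (((x.2.rev, Q - x.1), 1), 1)] *
                    vertexFn L M β (gaussConv ℂ (hubbardCovBelowCT L M β μ 0 K Λ) (hubbardEffectiveActionCT L M β U μ 0 K Λ)) 4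
                      ![((p, 0), 0), ((p', 1), 1), (((y.2.rev, Q - y.1), 1), 0), (((x.2, x.1), 0), 1)])
              else 0) -
            2 * ∑ p : FreqMomentum L M, ∑ σ : Fin 2,
              ((((deriv (fun Λ' : ℝ => hubbardCutoffWeightCT L M β μ K Λ' p) Λ : ℝ) : ℂ) *
                  (((β * (L : ℝ) ^ 2 : ℝ) : ℂ) * propCT L M β μ K p)) *
                (((1 - hubbardCutoffWeightCT L M β μ K Λ p : ℝ) : ℂ) * (((β * (L : ℝ) ^ 2 : ℝ) : ℂ) * propCT L M β μ K p))) *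
              (vertexFn L M β (gaussConv ℂ (hubbardCovBelowCT L M β μ 0 K Λ) (hubbardEffectiveActionCT L M β U μ 0 K Λ)) 6
                  ![((p, σ), 0), ((p, σ), 1), (((y.2, y.1), 0), 0), (((y.2.rev, Q - y.1), 1), 0), (((x.2.rev, Q - x.1), 1), 1),
                    (((x.2, x.1), 0), 1)] *
                selfEnergy L M β (gaussConv ℂ (hubbardCovBelowCT L M β μ 0 K Λ) (hubbardEffectiveActionCT L M β U μ 0 K Λ)) p σ))) := by
  -- split `e^{Δ_×(D)} = (e^{Δ_×(D)} − Δ_×(D)) + Δ_×(D)` and read the two-line class by the three-channel identity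
  set P := dblCopy ℂ 0 (gaussConv ℂ (hubbardCovBelowCT L M β μ 0 K Λ) (hubbardEffectiveActionCT L M β U μ 0 K Λ)) *
    dblCopy ℂ 1 (gaussConv ℂ (hubbardCovBelowCT L M β μ 0 K Λ) (hubbardEffectiveActionCT L M β U μ 0 K Λ)) with hP
  have hsplit : gaussConv ℂ (crossCov ℂ (hubbardCovBelowCT L M β μ 0 K Λ)) P =
      (gaussConv ℂ (crossCov ℂ (hubbardCovBelowCT L M β μ 0 K Λ)) - grassmannLaplacian ℂ (crossCov ℂ (hubbardCovBelowCT L M β μ 0 K Λ))) P +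
        grassmannLaplacian ℂ (crossCov ℂ (hubbardCovBelowCT L M β μ 0 K Λ)) P := by
    rw [LinearMap.sub_apply, sub_add_cancel]
  have h2 := vertexFn_dblFold_bubble_pairKernel_wickActionR β U μ K hβ (klws_contr_derivHardCov_eq_diagContr L M hβ μ K hΛ)
    (klws_contr_covBelowCT_eq_diagContr L M hβ μ K Λ) Λ Q x y
  rw [hsplit, map_add, map_add, vertexFn_add, h2]
  ring

end Model

end Summit.HubbardSuperconductivity.HubbardSuperconductivity.Theorems.KLRegimeWick

end
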